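import Summits.CriticalPhenomena.CardyFormulaZ2.Theorems.CardyWhiteToColouredSimilarityUpgradeHeartsCoincide

/-!
# `SimilarityUpgrade` IS "its own hypothesis implies stmt-0794" — crux stmt-CriticalPhenomena-4597,
# line `registered`, lead c6

Route `CardyWhiteToColoured`, sub-problem `CardyFormulaZ2`. Write **(H)** for the hypothesis of the
crux `SimilarityUpgrade` (stmt-4597) — some `Φ` is the full limit of the bond-ℤ² crossing
probabilities of every conformal rectangle AND is invariant under all similarities `z ↦ a z + w`,
`a ≠ 0` — and **S1** for the registered heart `stub_rectilinearInvariance` of the shared crux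
`ConfInvTransport` (stmt-0794): rectilinear conformal rectangles with uniformizing data of equal
cross-ratio have asymptotically equal crossing probabilities (limit-free).

Leads c3–c5 proved: `ConfInvTransport ⇒ SimilarityUpgrade` and S1 ⇒ H3 unconditionally; and the
converse directions either modulo the named fact DKKMO Cor. 1.3 (`hearts_tfae_of_limitExists`) or for
the variant H3'' of the heart with the similarity hypothesis deleted (`stub_heartSansSim`). This file
closes that small gap with four unconditional equivalences over tree theorems, using NO named fact
and NOT altering the heart:

* `similarityUpgrade_iff_hyp_imp_rectilinearInvariance` — `SimilarityUpgrade ↔ ((H) → S1)`;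
* `similarityUpgrade_iff_hyp_imp_confInvTransport` — `SimilarityUpgrade ↔ ((H) → ConfInvTransport)`;
* `similarityUpgrade_iff_hyp_imp_thesis` — `SimilarityUpgrade ↔ ((H) → X_U)` (currying; X_U =
  `CardyUniqueLimitThesis`, stmt-0745);
* `rectilinearHeart_iff_hyp_imp_rectilinearInvariance` — `H3 ↔ ((H) → S1)` for the registered heart.

So, as filed, stmt-4597 is *literally* the statement "(H) implies stmt-0794" (equivalently "(H)
implies S1", "(H) implies X_U"): it has no content of its own beyond the conformal step of
stmt-0794 relativised to its hypothesis, and it closes mechanically the moment S1 or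
`ConfInvTransport` lands (`similarityUpgrade_of_rectilinearInvariance`,
`similarityUpgrade_of_confInvTransport`). The proofs are pure logic over
`rectilinearInvariance_of_thesis`, `confInvTransport_of_thesis` (X_U ⇒ S1, X_U ⇒ ConfInvTransport),
`similarityUpgrade_of_rectilinearInvariance`, `similarityUpgrade_of_confInvTransport` and
`rectilinearHeart_iff_similarityUpgrade`.

References: O. Schramm, Proc. ICM 2006, §2.6 Problem 2.11; S. Smirnov, C. R. Acad. Sci. 333 (2001),
Thm 1 and closing remark; H. Duminil-Copin, K. K. Kozlowski, D. Krachun, I. Manolescu, M. Oulamara,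
arXiv:2012.11672, §1.1.
-/

noncomputable section

namespace Summit.CriticalPhenomena.CardyFormulaZ2.Theorems.SimilarityUpgradeReduction

open Filter Topology Set
open Literature.Probability.RandomPlanarGeometry
open Literature.Probability.Percolation (bondDomainCrossingProb)
open Summit.CriticalPhenomena.CardyFormulaZ2.Theses
open Summit.CriticalPhenomena.CardyFormulaZ2.Theses.CardyUniqueLimit (CardyUniqueLimitThesis
  ConfInvTransport)

/-- **`SimilarityUpgrade ↔ ((H) → X_U)`**: the crux is by definition the implication from its
hypothesis (H) (a full, similarity-invariant limit `Φ` exists) to `CardyUniqueLimitThesis`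
(stmt-0745); recorded for reference next to the two informative forms below. -/
theorem similarityUpgrade_iff_hyp_imp_thesis :
    CardyWhiteToColoured.SimilarityUpgrade ↔
      ((∃ Φ : ConformalRectangle → ℝ,
          (∀ R : ConformalRectangle, Tendsto (bondDomainCrossingProb R) (𝓝[>] (0 : ℝ)) (𝓝 (Φ R))) ∧
          ∀ (R R' : ConformalRectangle) (a w : ℂ), a ≠ 0 →
            R'.carrier = (fun z : ℂ => a * z + w) '' R.carrier →
            R'.arc 0 = (fun z : ℂ => a * z + w) '' R.arc 0 →
            R'.arc 2 = (fun z : ℂ => a * z + w) '' R.arc 2 → Φ R' = Φ R) →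
        CardyUniqueLimitThesis) :=
  Iff.rfl

/-- **`SimilarityUpgrade ↔ ((H) → S1)`**, unconditionally and with no named fact: the crux
stmt-4597 is exactly "its hypothesis (H) implies the heart S1 of stmt-0794". Forward: (H) and the
crux give X_U, and X_U ⇒ S1 (`rectilinearInvariance_of_thesis`). Backward: under (H), S1 holds, and
S1 ⇒ `SimilarityUpgrade` (`similarityUpgrade_of_rectilinearInvariance`), which is applied to (H). -/
theorem similarityUpgrade_iff_hyp_imp_rectilinearInvariance :
    CardyWhiteToColoured.SimilarityUpgrade ↔
      ((∃ Φ : ConformalRectangle → ℝ,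
          (∀ R : ConformalRectangle, Tendsto (bondDomainCrossingProb R) (𝓝[>] (0 : ℝ)) (𝓝 (Φ R))) ∧
          ∀ (R R' : ConformalRectangle) (a w : ℂ), a ≠ 0 →
            R'.carrier = (fun z : ℂ => a * z + w) '' R.carrier →
            R'.arc 0 = (fun z : ℂ => a * z + w) '' R.arc 0 →
            R'.arc 2 = (fun z : ℂ => a * z + w) '' R.arc 2 → Φ R' = Φ R) →
        ∀ (Q Q' : ConformalRectangle),
          (∃ S : Finset (ℂ × ℂ), (∀ p ∈ S, p.1.re = p.2.re ∨ p.1.im = p.2.im) ∧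
            frontier Q.carrier ⊆ ⋃ p ∈ S, segment ℝ p.1 p.2) →
          (∃ S : Finset (ℂ × ℂ), (∀ p ∈ S, p.1.re = p.2.re ∨ p.1.im = p.2.im) ∧
            frontier Q'.carrier ⊆ ⋃ p ∈ S, segment ℝ p.1 p.2) →
          ∀ (ψ : ConformalEquiv UpperHalfPlane.upperHalfPlaneSet Q.carrier) (y : Fin 4 → ℝ)
            (ψ' : ConformalEquiv UpperHalfPlane.upperHalfPlaneSet Q'.carrier) (y' : Fin 4 → ℝ),
            Q.IsUniformizing ψ y → Q'.IsUniformizing ψ' y' → crossRatio y = crossRatio y' →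
            Tendsto (fun δ : ℝ => bondDomainCrossingProb Q δ - bondDomainCrossingProb Q' δ)
              (𝓝[>] (0 : ℝ)) (𝓝 0)) := by
  constructor
  · intro hS hH
    exact rectilinearInvariance_of_thesis (hS hH)
  · intro h hH
    exact similarityUpgrade_of_rectilinearInvariance (h hH) hH

/-- **`SimilarityUpgrade ↔ ((H) → ConfInvTransport)`**, unconditionally and with no named fact:
the crux stmt-4597 is exactly "its hypothesis (H) implies stmt-0794". Forward through X_U
(`confInvTransport_of_thesis`); backward by `similarityUpgrade_of_confInvTransport` applied to (H). -/
theorem similarityUpgrade_iff_hyp_imp_confInvTransport :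
    CardyWhiteToColoured.SimilarityUpgrade ↔
      ((∃ Φ : ConformalRectangle → ℝ,
          (∀ R : ConformalRectangle, Tendsto (bondDomainCrossingProb R) (𝓝[>] (0 : ℝ)) (𝓝 (Φ R))) ∧
          ∀ (R R' : ConformalRectangle) (a w : ℂ), a ≠ 0 →
            R'.carrier = (fun z : ℂ => a * z + w) '' R.carrier →
            R'.arc 0 = (fun z : ℂ => a * z + w) '' R.arc 0 →
            R'.arc 2 = (fun z : ℂ => a * z + w) '' R.arc 2 → Φ R' = Φ R) →
        ConfInvTransport) := by
  constructor
  · intro hS hH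
    exact confInvTransport_of_thesis (hS hH)
  · intro h hH
    exact similarityUpgrade_of_confInvTransport (h hH) hH

/-- **`H3 ↔ ((H) → S1)`** for the registered heart `stub_rectilinearHeart` of line `registered`,
unconditionally and with no named fact (H3 ⟺ crux, `rectilinearHeart_iff_similarityUpgrade`, then
`similarityUpgrade_iff_hyp_imp_rectilinearInvariance`): the one open stub of this line is exactly
"(H) implies the heart S1 of stmt-0794". -/
theorem rectilinearHeart_iff_hyp_imp_rectilinearInvariance :
    (∀ Φ : ConformalRectangle → ℝ,
      (∀ R : ConformalRectangle, Tendsto (bondDomainCrossingProb R) (𝓝[>] (0 : ℝ)) (𝓝 (Φ R))) →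
      (∀ (R R' : ConformalRectangle) (a w : ℂ), a ≠ 0 →
        R'.carrier = (fun z : ℂ => a * z + w) '' R.carrier →
        R'.arc 0 = (fun z : ℂ => a * z + w) '' R.arc 0 →
        R'.arc 2 = (fun z : ℂ => a * z + w) '' R.arc 2 → Φ R' = Φ R) →
      ∀ (R R' : ConformalRectangle),
        (∃ S : Finset (ℂ × ℂ), (∀ p ∈ S, p.1.re = p.2.re ∨ p.1.im = p.2.im) ∧
          frontier R.carrier ⊆ ⋃ p ∈ S, segment ℝ p.1 p.2) →
        (∃ w : ℝ, 0 < w ∧ R'.carrier = (Ioo (0 : ℝ) w ×ℂ Ioo (0 : ℝ) 1) ∧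
          R'.arc 0 = {z : ℂ | z.re = 0 ∧ z.im ∈ Icc (0 : ℝ) 1} ∧
          R'.arc 2 = {z : ℂ | z.re = w ∧ z.im ∈ Icc (0 : ℝ) 1} ∧
          R'.pt 0 = Complex.I ∧ R'.pt 1 = 0 ∧ R'.pt 2 = (w : ℂ) ∧ R'.pt 3 = (w : ℂ) + Complex.I) →
        ∀ (φ : ConformalEquiv UpperHalfPlane.upperHalfPlaneSet R.carrier) (x : Fin 4 → ℝ)
          (φ' : ConformalEquiv UpperHalfPlane.upperHalfPlaneSet R'.carrier) (x' : Fin 4 → ℝ),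
          R.IsUniformizing φ x → R'.IsUniformizing φ' x' → crossRatio x = crossRatio x' →
          Φ R = Φ R') ↔
      ((∃ Φ : ConformalRectangle → ℝ,
          (∀ R : ConformalRectangle, Tendsto (bondDomainCrossingProb R) (𝓝[>] (0 : ℝ)) (𝓝 (Φ R))) ∧
          ∀ (R R' : ConformalRectangle) (a w : ℂ), a ≠ 0 →
            R'.carrier = (fun z : ℂ => a * z + w) '' R.carrier →
            R'.arc 0 = (fun z : ℂ => a * z + w) '' R.arc 0 →
            R'.arc 2 = (fun z : ℂ => a * z + w) '' R.arc 2 → Φ R' = Φ R) →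
        ∀ (Q Q' : ConformalRectangle),
          (∃ S : Finset (ℂ × ℂ), (∀ p ∈ S, p.1.re = p.2.re ∨ p.1.im = p.2.im) ∧
            frontier Q.carrier ⊆ ⋃ p ∈ S, segment ℝ p.1 p.2) →
          (∃ S : Finset (ℂ × ℂ), (∀ p ∈ S, p.1.re = p.2.re ∨ p.1.im = p.2.im) ∧
            frontier Q'.carrier ⊆ ⋃ p ∈ S, segment ℝ p.1 p.2) →
          ∀ (ψ : ConformalEquiv UpperHalfPlane.upperHalfPlaneSet Q.carrier) (y : Fin 4 → ℝ)
            (ψ' : ConformalEquiv UpperHalfPlane.upperHalfPlaneSet Q'.carrier) (y' : Fin 4 → ℝ),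
            Q.IsUniformizing ψ y → Q'.IsUniformizing ψ' y' → crossRatio y = crossRatio y' →
            Tendsto (fun δ : ℝ => bondDomainCrossingProb Q δ - bondDomainCrossingProb Q' δ)
              (𝓝[>] (0 : ℝ)) (𝓝 0)) :=
  rectilinearHeart_iff_similarityUpgrade.trans similarityUpgrade_iff_hyp_imp_rectilinearInvariance

/-- **stub_hypImpTransport (c6 goal, documentary; registered on stmt-4597).** The crux
`SimilarityUpgrade` is equivalent, with no named fact, both to "(H) → `ConfInvTransport`" (stmt-0794)
and to "(H) → S1" (the registered heart of stmt-0794's line `birth`), where (H) is the crux's own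
hypothesis (a full, similarity-invariant limit exists). Conjunction of
`similarityUpgrade_iff_hyp_imp_confInvTransport` and `similarityUpgrade_iff_hyp_imp_rectilinearInvariance`. -/
theorem stub_hypImpTransport : (Summit.CriticalPhenomena.CardyFormulaZ2.Theses.CardyWhiteToColoured.SimilarityUpgrade ↔ ((∃ Φ : ConformalRectangle → ℝ, (∀ R : ConformalRectangle, Tendsto (bondDomainCrossingProb R) (𝓝[>] (0 : ℝ)) (𝓝 (Φ R))) ∧ ∀ (R R' : ConformalRectangle) (a w : ℂ), a ≠ 0 → R'.carrier = (fun z : ℂ => a * z + w) '' R.carrier → R'.arc 0 = (fun z : ℂ => a * z + w) '' R.arc 0 → R'.arc 2 = (fun z : ℂ => a * z + w) '' R.arc 2 → Φ R' = Φ R) → Summit.CriticalPhenomena.CardyFormulaZ2.Theses.CardyUniqueLimit.ConfInvTransport)) ∧ (Summit.CriticalPhenomena.CardyFormulaZ2.Theses.CardyWhiteToColoured.SimilarityUpgrade ↔ ((∃ Φ : ConformalRectangle → ℝ, (∀ R : ConformalRectangle, Tendsto (bondDomainCrossingProb R) (𝓝[>] (0 : ℝ)) (𝓝 (Φ R)))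 ∧ ∀ (R R' : ConformalRectangle) (a w : ℂ), a ≠ 0 → R'.carrier = (fun z : ℂ => a * z + w) '' R.carrier → R'.arc 0 = (fun z : ℂ => a * z + w) '' R.arc 0 → R'.arc 2 = (fun z : ℂ => a * z + w) '' R.arc 2 → Φ R' = Φ R) → (∀ (Q Q' : ConformalRectangle), (∃ S : Finset (ℂ × ℂ), (∀ p ∈ S, p.1.re = p.2.re ∨ p.1.im = p.2.im) ∧ frontier Q.carrier ⊆ ⋃ p ∈ S, segment ℝ p.1 p.2) → (∃ S : Finset (ℂ × ℂ), (∀ p ∈ S, p.1.re = p.2.re ∨ p.1.im = p.2.im) ∧ frontier Q'.carrier ⊆ ⋃ p ∈ S, segment ℝ p.1 p.2) → ∀ (ψ : ConformalEquiv UpperHalfPlane.upperHalfPlaneSet Q.carrier) (y : Fin 4 → ℝ) (ψ' : ConformalEquiv UpperHalfPlane.upperHalfPlaneSet Q'.carrier) (y' : Fin 4 → ℝ), Q.IsUniformizing ψ y → Q'.IsUniformizing ψ' y' → crossRatio y = crossRatio y' → Tendsto (fun δ : ℝ => bondDomainCrossingProb Q δ - bondDomainCrossingProb Q' δ) (𝓝[>]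 (0 : ℝ)) (𝓝 0)))) :=
  ⟨similarityUpgrade_iff_hyp_imp_confInvTransport, similarityUpgrade_iff_hyp_imp_rectilinearInvariance⟩

end Summit.CriticalPhenomena.CardyFormulaZ2.Theorems.SimilarityUpgradeReduction

end
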